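import Literature.NumberTheory.LFunctions.WeilMarkovQuadratic

/-!
# Short-range asymptotics of the archimedean jump density of the Weil form

`weilArchDensity t = e^{t/2}/(2 sinh t)` (Bombieri 2000, Thm 2: the integrand `x dx/(x² − 1)`,
`x = e^t`, of the archimedean term of the explicit formula) is, at short range, HALF the increment
density `1/t` of the one-dimensional logarithmic Laplacian: `t · weilArchDensity t → 1/2` as
`t → 0⁺` (`tendsto_mul_weilArchDensity`), and exactly `e^{-t/2}/(1 − e^{-2t})`
(`weilArchDensity_eq_exp_div`). The constant `c₀ = 1/2` is the coefficient of the logarithmic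
singularity of the Weil energy form `∫₀^∞ w(t) D_t(g) dt` (`weilDirichletEnergy`) and fixes the
constant `2c₀ = 1` of Hadamard-type edge formulas for the window bottom (pub-rhpf THEORY-EDGE.md).
[cite: Bombieri2000Weil, Thm 2 (p. 193)]
-/

noncomputable section

open Filter Set
open scoped Real Topology

namespace Literature.NumberTheory.LFunctions

/-- `e^{t/2}/(2 sinh t) = e^{-t/2}/(1 − e^{-2t})` for `t ≠ 0` (the two printed shapes of Bombieri's
archimedean density). [cite: Bombieri2000Weil, Thm 2 (p. 193)] -/
theorem weilArchDensity_eq_exp_div {t : ℝ} (ht : t ≠ 0) :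
    weilArchDensity t = Real.exp (-(t / 2)) / (1 - Real.exp (-(2 * t))) := by
  have hs : Real.sinh t ≠ 0 := by
    intro h; exact ht (Real.sinh_eq_zero.mp h)
  have h1 : 1 - Real.exp (-(2 * t)) ≠ 0 := by
    intro h
    have : Real.exp (-(2 * t)) = 1 := by linarith
    rw [Real.exp_eq_one_iff] at this
    exact ht (by linarith)
  unfold weilArchDensity
  rw [div_eq_div_iff (mul_ne_zero two_ne_zero hs) h1, Real.sinh_eq]
  have e1 : Real.exp (t / 2) * Real.exp (-(2 * t)) = Real.exp (-(t / 2)) * Real.exp (-t) := by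
    rw [← Real.exp_add, ← Real.exp_add]; ring_nf
  have e2 : Real.exp (-(t / 2)) * Real.exp t = Real.exp (t / 2) := by
    rw [← Real.exp_add]; ring_nf
  calc Real.exp (t / 2) * (1 - Real.exp (-(2 * t)))
      = Real.exp (t / 2) - Real.exp (t / 2) * Real.exp (-(2 * t)) := by ring
    _ = Real.exp (-(t / 2)) * Real.exp t - Real.exp (-(t / 2)) * Real.exp (-t) := by rw [e1, e2]
    _ = Real.exp (-(t / 2)) * (2 * ((Real.exp t - Real.exp (-t)) / 2)) := by ring

/-- **`c₀ = 1/2`:** `t · weilArchDensity t → 1/2` as `t → 0⁺` — the archimedean density behaves like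
`1/(2t)` at short range (Bombieri 2000, remark after Thm 2; `sinh t ∼ t`).
[cite: Bombieri2000Weil, Thm 2 (p. 193)] -/
theorem tendsto_mul_weilArchDensity :
    Tendsto (fun t : ℝ ↦ t * weilArchDensity t) (𝓝[>] 0) (𝓝 (1 / 2)) := by
  have h1 : Tendsto (fun t : ℝ ↦ t⁻¹ * Real.sinh t) (𝓝[>] 0) (𝓝 1) := by
    have hd : HasDerivAt Real.sinh (Real.cosh 0) 0 := Real.hasDerivAt_sinh 0
    rw [Real.cosh_zero] at hd
    simpa [Real.sinh_zero] using hd.tendsto_slope_zero_right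
  have h2 : Tendsto (fun t : ℝ ↦ (t⁻¹ * Real.sinh t)⁻¹) (𝓝[>] 0) (𝓝 1) := by
    simpa using h1.inv₀ one_ne_zero
  have h3 : Tendsto (fun t : ℝ ↦ Real.exp (t / 2) / 2) (𝓝[>] 0) (𝓝 (1 / 2)) := by
    have hc : Continuous fun t : ℝ ↦ Real.exp (t / 2) / 2 :=
      (Real.continuous_exp.comp (continuous_id.div_const 2)).div_const 2
    have := hc.tendsto 0
    simp only [zero_div, Real.exp_zero] at this
    exact this.mono_left nhdsWithin_le_nhds
  have h4 := h3.mul h2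
  rw [mul_one] at h4
  refine h4.congr' ?_
  filter_upwards [self_mem_nhdsWithin] with t ht
  have ht' : (0 : ℝ) < t := ht
  have hs : Real.sinh t ≠ 0 := (Real.sinh_pos_iff.mpr ht').ne'
  unfold weilArchDensity
  field_simp

end Literature.NumberTheory.LFunctions

end
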